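import Summits.QuantumFields.GaugeBoot.BootstrapRPCutsZd
import Summits.QuantumFields.GaugeBoot.BootstrapConstrainedConvergence
import Summits.QuantumFields.GaugeBoot.ReflectionPositivityFromPolynomials
import HarnessLib

/-!
# The infinite-lattice bootstrap with symmetry and reflection-positivity cuts converges to the reflection-positive symmetric Gibbs states (gauge-boot, L1/L4 supplement)

HONEST FRAMING (cell `pub-gaugeboot`, page 1 of every file): the venture produces certified bounds
on lattice expectations at stated coupling, gauge group, dimension and torus size; NOT a mass gap,
NOT a continuum limit, NOT a string tension; NOT Yang–Mills-summit-bearing (barriers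
`FixedCouplingUltralocality`, `PerturbativeInvisibility`). Structural; it certifies no number.

## Content (`SU(N)` on `ℤ^d`, one-link Wilson boundary actions, any real `β`)

`BootstrapRPCutsZd` defined Kazakov–Zheng's level-`n` SDP with everything (`rpFullSymLevelValuesZdSuN`:
loop equations, positivity, the full lattice symmetry, site- and link-RP cuts) and proved it SOUND
for the reflection-positive fully symmetric Gibbs states, in particular for every thermodynamic limit
point of the torus states (`β ≥ 0`). Here the LIMIT of the level:

* `rpCutObservablesZd N n` / `rpCutObservablesZdAll N` — the cut observables `(F ∘ Θ_i) F`,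
  `(F ∘ Θ^link_i) F` at degree `n` / all degrees (polynomial, monotone in `n`);
* ★★★ `rpFullSymBootstrap_convergence_dlr_suN` — for every polynomial `P` and `ε > 0`, for `n`
  large every value of the level-`n` SDP with everything lies within `ε` of `∫ P dμ` for a Gibbs
  state `μ` which is invariant under the full lattice symmetry AND REFLECTION POSITIVE for every site
  mirror `x_i = 0` and every link mirror `x_i = ½` (`IsReflectionPositiveFor`, all bounded
  measurable half-observables): the untruncated cluster point carries all cuts
  (`bootstrap_convergence_constrained`), is realised by a DLR state (`exists_dlr_of_bootstrap_suN`),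
  and polynomial RP cuts of an invariant state give full RP (`IsReflectionPositiveFor.of_wordSpace`);
* ★★★ `rpFullSymLevelValuesZd_hausdorff_suN` — with soundness: the hierarchy with everything
  converges to EXACTLY the range of `P` over the reflection-positive fully symmetric Gibbs states;
* ★★ `exists_dlr_rp_fullSpaceGroupInvariant_suN` (`β ≥ 0`) — such states exist (torus limit
  points).

What this is NOT: the diagonal mirrors; `β < 0` existence; whether RP cuts change any limit value
(they do not change soundness; they may shrink the finite-level sets); rates.

References: V. Kazakov, Z. Zheng, arXiv:2203.11360 §3, arXiv:2404.16925 §3.2; K. Osterwalder,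
E. Seiler, Ann. Phys. 110 (1978) 440. Folklore.
-/

noncomputable section

open MeasureTheory Filter Topology
open scoped ComplexOrder
open Literature.MathematicalPhysics.QuantumFieldTheory (LatticeRep)
open Literature.Probability.LatticeModels (Site)
open Literature.MathematicalPhysics.QuantumLattice

namespace Summit.QuantumFields.GaugeBoot

section ZdSuN

variable {d : ℕ} (N : ℕ) (β : ℝ)

/-- **The RP cut observables at degree `n`**: `(F ∘ Θ_i) · F` for `F` in the degree-`n` word space
at a site half-space, and `(F ∘ Θ^link_i) · F` at a link half-space. -/
def rpCutObservablesZd (n : ℕ) : Set C(LGConfig d (Matrix.specialUnitaryGroup (Fin N) ℂ), ℝ) :=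
  {b | ∃ (i : Fin d) (F : C(LGConfig d (Matrix.specialUnitaryGroup (Fin N) ℂ), ℝ)),
      F ∈ wordSpace (fundamentalLatticeRep N) (siteHalfEdges i) n ∧
        F.comp (zdSiteReflectCM (G := Matrix.specialUnitaryGroup (Fin N) ℂ) i) * F = b} ∪
  {b | ∃ (i : Fin d) (F : C(LGConfig d (Matrix.specialUnitaryGroup (Fin N) ℂ), ℝ)),
      F ∈ wordSpace (fundamentalLatticeRep N) (linkHalfEdges i) n ∧
        F.comp (zdLinkReflectCM (G := Matrix.specialUnitaryGroup (Fin N) ℂ) i) * F = b}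

/-- All RP cut observables. -/
def rpCutObservablesZdAll (d N : ℕ) : Set C(LGConfig d (Matrix.specialUnitaryGroup (Fin N) ℂ), ℝ) :=
  ⋃ n, rpCutObservablesZd (d := d) N n

/-- The cut observables are monotone in the degree. -/
theorem rpCutObservablesZd_mono {m n : ℕ} (hmn : m ≤ n) :
    rpCutObservablesZd (d := d) N m ⊆ rpCutObservablesZd (d := d) N n := by
  rintro b (⟨i, F, hF, rfl⟩ | ⟨i, F, hF, rfl⟩)
  · exact Or.inl ⟨i, F, wordSpace_mono _ subset_rfl hmn hF, rfl⟩
  · exact Or.inr ⟨i, F, wordSpace_mono _ subset_rfl hmn hF, rfl⟩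

/-- The cut observables are polynomial. -/
theorem rpCutObservablesZdAll_subset_polyAlgebra :
    ∀ b ∈ rpCutObservablesZdAll d N, b ∈ polyAlgebra (ι := ZdEdge d) (fundamentalLatticeRep N) := by
  rintro b hb
  obtain ⟨n, hn⟩ := Set.mem_iUnion.1 hb
  rcases hn with ⟨i, F, hF, rfl⟩ | ⟨i, F, hF, rfl⟩
  · have hFp := mem_polyAlgebra_of_mem_wordSpace (fundamentalLatticeRep N) hF
    exact (polyAlgebra _).mul_mem (comp_zdSiteReflectCM_mem_polyAlgebra i _ hFp) hFp
  · have hFp := mem_polyAlgebra_of_mem_wordSpace (fundamentalLatticeRep N) hF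
    refine (polyAlgebra _).mul_mem ?_ hFp
    rw [comp_zdLinkReflectCM]
    exact comp_relabelCM_mem_polyAlgebra _ _ (comp_zdSiteReflectCM_mem_polyAlgebra i _ hFp)

/-- A functional with the site and link cuts at degree `n` is non-negative on the degree-`n` cut
observables. -/
theorem nonneg_of_mem_rpCutObservablesZd {n : ℕ}
    {φ : C(LGConfig d (Matrix.specialUnitaryGroup (Fin N) ℂ), ℝ) →ₗ[ℝ] ℝ}
    (hsite : IsSiteRPCutFunctional (fundamentalLatticeRep N) n φ)
    (hlink : IsLinkRPCutFunctional (fundamentalLatticeRep N) n φ) :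
    ∀ b ∈ rpCutObservablesZd (d := d) N n, 0 ≤ φ b := by
  rintro b (⟨i, F, hF, rfl⟩ | ⟨i, F, hF, rfl⟩)
  · exact hsite i F hF
  · exact hlink i F hF

/-- ★★★ **The bootstrap with everything converges to the reflection-positive symmetric Gibbs
states.** `SU(N)` on `ℤ^d`, any real `β`: for every polynomial observable `P` and `ε > 0` there is
a level `n` such that every value of the level-`n` SDP with loop equations, positivity, the full
lattice symmetry and the site- and link-RP cuts lies within `ε` of `∫ P dμ` for a Gibbs state `μ`
invariant under translations, axis permutations and axis reflections AND reflection positive for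
every site mirror and every link mirror. [folklore] -/
theorem rpFullSymBootstrap_convergence_dlr_suN
    {P : C(LGConfig d (Matrix.specialUnitaryGroup (Fin N) ℂ), ℝ)}
    (hP : P ∈ polyAlgebra (ι := ZdEdge d) (fundamentalLatticeRep N)) {ε : ℝ} (hε : 0 < ε) :
    ∃ n, ∀ t ∈ rpFullSymLevelValuesZdSuN (d := d) N β n P,
      ∃ μ ∈ ymGibbsMeasures (d := d) (fundamentalRep (Fin N)) β,
        IsZdTranslationInvariant μ ∧ (∀ σ : Equiv.Perm (Fin d), μ.map (relabelConfig (edgePerm σ)) = μ) ∧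
          (∀ i : Fin d, μ.map (configSiteReflect i) = μ) ∧
          (∀ i : Fin d, IsReflectionPositiveFor (configSiteReflect (G := Matrix.specialUnitaryGroup (Fin N) ℂ) i)
            (siteHalfEdges i) μ) ∧
          (∀ i : Fin d, IsReflectionPositiveFor (configLinkReflect (G := Matrix.specialUnitaryGroup (Fin N) ℂ) i)
            (linkHalfEdges i) μ) ∧
          |t - ∫ U, P U ∂μ| ≤ ε := by
  haveI : SecondCountableTopology (Matrix (Fin N) (Fin N) ℂ) :=
    inferInstanceAs (SecondCountableTopology (Fin N → Fin N → ℂ))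
  haveI : SecondCountableTopology (Matrix.specialUnitaryGroup (Fin N) ℂ) :=
    Topology.IsEmbedding.subtypeVal.secondCountableTopology
  obtain ⟨n, hn⟩ := bootstrap_convergence_constrained (fundamentalLatticeRep N) (suExp_add N)
    (X := fun X : SuGenerator N => (X : Matrix (Fin N) (Fin N) ℂ)) (rho_suExp N)
    (S := fun e => wilsonBoundaryAction (fundamentalRep (Fin N)) {e}) (β := β)
    (fun e => wilsonBoundaryAction_mem_polyFunctions (fundamentalLatticeRep N) {e})
    (fun n => wordTruncation (ι := ZdEdge d) (fundamentalLatticeRep N) n)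
    (fun a ha => eventually_mem_wordTruncation (fundamentalLatticeRep N) ha)
    (fullSpaceGroupMaps d N)
    (fun R hR a ha => comp_mem_polyAlgebra_of_mem_fullSpaceGroupMaps N hR ha)
    (fun n => rpCutObservablesZd (d := d) N n) (rpCutObservablesZdAll d N)
    (rpCutObservablesZdAll_subset_polyAlgebra N)
    (fun b hb => by
      obtain ⟨m, hm⟩ := Set.mem_iUnion.1 hb
      exact eventually_atTop.2 ⟨m, fun n hmn => rpCutObservablesZd_mono N hmn hm⟩)
    hP hε
  refine ⟨n, ?_⟩
  rintro t ⟨φ, hφ, hT, hperm, hrefl, hsite, hlink, rfl⟩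
  obtain ⟨ψ, hψ, hψinv, hψcut, hclose⟩ := hn φ hφ (by
    rintro R ((⟨v, rfl⟩ | ⟨σ, rfl⟩) | ⟨i, rfl⟩) a ha
    · exact hT v a (wordTruncation_mono _ (Nat.le_add_right n n) ha)
    · exact hperm σ a (wordTruncation_mono _ (Nat.le_add_right n n) ha)
    · exact hrefl i a (wordTruncation_mono _ (Nat.le_add_right n n) ha))
    (nonneg_of_mem_rpCutObservablesZd N hsite hlink)
  obtain ⟨μ, hμ, hψμ⟩ := exists_dlr_of_bootstrap_suN N β hψ.1 hψ.2.1 hψ.2.2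
  haveI := hμ.1
  have hmom : ∀ R, R ∈ fullSpaceGroupMaps d N →
      ∀ a ∈ polyAlgebra (ι := ZdEdge d) (fundamentalLatticeRep N), ∫ U, a (R U) ∂μ = ∫ U, a U ∂μ := by
    intro R hR a ha
    have h2 := hψμ _ (comp_mem_polyAlgebra_of_mem_fullSpaceGroupMaps N hR ha)
    simp only [ContinuousMap.comp_apply] at h2
    rw [← h2, ← hψμ a ha]
    exact hψinv R hR a ha
  have hTμ : IsZdTranslationInvariant μ :=
    isZdTranslationInvariant_of_forall_poly N (fun v a ha => hmom _ (Or.inl (Or.inl ⟨v, rfl⟩)) a ha)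
  have hreflμ : ∀ i : Fin d, μ.map (configSiteReflect i) = μ :=
    isSiteReflectInvariant_of_forall_poly N fun i a ha => by
      have h := hmom _ (Or.inr ⟨i, rfl⟩) a ha
      simp only [zdSiteReflectCM_apply] at h
      exact h
  -- the polynomial cuts of `μ`
  have hcutμ : ∀ b ∈ rpCutObservablesZdAll d N, 0 ≤ ∫ U, b U ∂μ := fun b hb => by
    rw [← hψμ b (rpCutObservablesZdAll_subset_polyAlgebra N b hb)]
    exact hψcut b hb
  refine ⟨μ, hμ, hTμ, isAxisPermInvariant_of_forall_poly N (fun σ a ha => hmom _ (Or.inl (Or.inr ⟨σ, rfl⟩)) a ha),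
    hreflμ, fun i => ?_, fun i => ?_, ?_⟩
  · -- site RP from the polynomial site cuts
    have hmp : MeasurePreserving (zdSiteReflectCM (G := Matrix.specialUnitaryGroup (Fin N) ℂ) i) μ μ := by
      refine ⟨by rw [coe_zdSiteReflectCM]; exact measurable_configSiteReflect i, ?_⟩
      rw [coe_zdSiteReflectCM]
      exact hreflμ i
    have h := IsReflectionPositiveFor.of_wordSpace (fundamentalLatticeRep N) (S := siteHalfEdges i)
      (zdSiteReflectCM (G := Matrix.specialUnitaryGroup (Fin N) ℂ) i) hmp (zdSiteReflectCM_zdSiteReflectCM i)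
      fun m F hF => by
        have hb : F.comp (zdSiteReflectCM (G := Matrix.specialUnitaryGroup (Fin N) ℂ) i) * F ∈ rpCutObservablesZdAll d N :=
          Set.mem_iUnion.2 ⟨m, Or.inl ⟨i, F, hF, rfl⟩⟩
        simpa only [ContinuousMap.mul_apply, ContinuousMap.comp_apply] using hcutμ _ hb
    rwa [coe_zdSiteReflectCM] at h
  · -- link RP from the polynomial link cuts
    have hcoe : ⇑(zdLinkReflectCM (G := Matrix.specialUnitaryGroup (Fin N) ℂ) i) =
        (configLinkReflect i : LGConfig d (Matrix.specialUnitaryGroup (Fin N) ℂ) → _) :=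
      funext (zdLinkReflectCM_apply i)
    have hmp : MeasurePreserving (zdLinkReflectCM (G := Matrix.specialUnitaryGroup (Fin N) ℂ) i) μ μ := by
      refine ⟨by rw [hcoe]; exact measurable_configLinkReflect i, ?_⟩
      rw [hcoe]
      exact map_configLinkReflect_eq_of_invariant N hTμ (hreflμ i)
    have h := IsReflectionPositiveFor.of_wordSpace (fundamentalLatticeRep N) (S := linkHalfEdges i)
      (zdLinkReflectCM (G := Matrix.specialUnitaryGroup (Fin N) ℂ) i) hmp
      (fun U => by rw [zdLinkReflectCM_apply, zdLinkReflectCM_apply, configLinkReflect_configLinkReflect])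
      fun m F hF => by
        have hb : F.comp (zdLinkReflectCM (G := Matrix.specialUnitaryGroup (Fin N) ℂ) i) * F ∈ rpCutObservablesZdAll d N :=
          Set.mem_iUnion.2 ⟨m, Or.inr ⟨i, F, hF, rfl⟩⟩
        simpa only [ContinuousMap.mul_apply, ContinuousMap.comp_apply] using hcutμ _ hb
    rwa [hcoe] at h
  · rwa [hψμ P hP] at hclose

/-- ★★★ **Hausdorff form: the hierarchy with everything converges to EXACTLY the range of `P` over
the reflection-positive fully symmetric Gibbs states** — every value at a large level is `ε`-close
to such an expectation, and every such expectation is a value at every level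
(`dlr_integral_mem_rpFullSymLevelValuesZd`). -/
theorem rpFullSymLevelValuesZd_hausdorff_suN
    {P : C(LGConfig d (Matrix.specialUnitaryGroup (Fin N) ℂ), ℝ)}
    (hP : P ∈ polyAlgebra (ι := ZdEdge d) (fundamentalLatticeRep N)) {ε : ℝ} (hε : 0 < ε) :
    ∃ n, (∀ t ∈ rpFullSymLevelValuesZdSuN (d := d) N β n P,
        ∃ μ ∈ ymGibbsMeasures (d := d) (fundamentalRep (Fin N)) β,
          IsZdTranslationInvariant μ ∧ (∀ σ : Equiv.Perm (Fin d), μ.map (relabelConfig (edgePerm σ)) = μ) ∧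
            (∀ i : Fin d, μ.map (configSiteReflect i) = μ) ∧
            (∀ i : Fin d, IsReflectionPositiveFor (configSiteReflect (G := Matrix.specialUnitaryGroup (Fin N) ℂ) i)
              (siteHalfEdges i) μ) ∧
            (∀ i : Fin d, IsReflectionPositiveFor (configLinkReflect (G := Matrix.specialUnitaryGroup (Fin N) ℂ) i)
              (linkHalfEdges i) μ) ∧
            |t - ∫ U, P U ∂μ| ≤ ε) ∧
      ∀ μ ∈ ymGibbsMeasures (d := d) (fundamentalRep (Fin N)) β, IsZdTranslationInvariant μ →
        (∀ σ : Equiv.Perm (Fin d), μ.map (relabelConfig (edgePerm σ)) = μ) →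
          (∀ i : Fin d, μ.map (configSiteReflect i) = μ) →
          (∀ i : Fin d, IsReflectionPositiveFor (configSiteReflect (G := Matrix.specialUnitaryGroup (Fin N) ℂ) i)
            (siteHalfEdges i) μ) →
          (∀ i : Fin d, IsReflectionPositiveFor (configLinkReflect (G := Matrix.specialUnitaryGroup (Fin N) ℂ) i)
            (linkHalfEdges i) μ) →
            ∫ U, P U ∂μ ∈ rpFullSymLevelValuesZdSuN (d := d) N β n P := by
  obtain ⟨n, hn⟩ := rpFullSymBootstrap_convergence_dlr_suN N β hP hε
  exact ⟨n, hn, fun μ hμ hT hperm hrefl hsite hlink =>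
    dlr_integral_mem_rpFullSymLevelValuesZd N β n hμ hT hperm hrefl hsite hlink P⟩

/-- ★★ **`β ≥ 0`: reflection-positive fully symmetric Gibbs states exist** (the thermodynamic
limit points of the torus Wilson states). -/
theorem exists_dlr_rp_fullSpaceGroupInvariant_suN [NeZero d] {β : ℝ} (hβ : 0 ≤ β) :
    ∃ μ ∈ ymGibbsMeasures (d := d) (fundamentalRep (Fin N)) β,
      IsZdTranslationInvariant μ ∧ (∀ σ : Equiv.Perm (Fin d), μ.map (relabelConfig (edgePerm σ)) = μ) ∧
        (∀ i : Fin d, μ.map (configSiteReflect i) = μ) ∧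
        (∀ i : Fin d, IsReflectionPositiveFor (configSiteReflect (G := Matrix.specialUnitaryGroup (Fin N) ℂ) i)
          (siteHalfEdges i) μ) ∧
        (∀ i : Fin d, IsReflectionPositiveFor (configLinkReflect (G := Matrix.specialUnitaryGroup (Fin N) ℂ) i)
          (linkHalfEdges i) μ) := by
  haveI : SecondCountableTopology (Matrix (Fin N) (Fin N) ℂ) :=
    inferInstanceAs (SecondCountableTopology (Fin N → Fin N → ℂ))
  haveI : SecondCountableTopology (Matrix.specialUnitaryGroup (Fin N) ℂ) :=
    Topology.IsEmbedding.subtypeVal.secondCountableTopology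
  have hρ := continuous_fundamentalRep (Fin N)
  obtain ⟨μ, hμ⟩ := infiniteVolumeLimitPoints_nonempty_holds (d := d) (fundamentalRep (Fin N)) hρ β
  refine ⟨μ, mem_ymGibbsMeasures_of_mem_infiniteVolumeLimitPoints_holds (fundamentalRep (Fin N)) hρ hμ,
    isZdTranslationInvariant_of_mem_infiniteVolumeLimitPoints (fundamentalRep (Fin N)) hμ, fun σ => ?_,
    fun i => (reflectInvariant_of_mem_infiniteVolumeLimitPoints (fundamentalRep (Fin N)) hρ hμ i).map_eq,
    siteRP_of_mem_infiniteVolumeLimitPoints (fundamentalRep (Fin N)) hρ hβ hμ,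
    linkRP_of_mem_infiniteVolumeLimitPoints (fundamentalRep (Fin N)) hρ hβ hμ⟩
  have h := (permInvariant_of_mem_infiniteVolumeLimitPoints (fundamentalRep (Fin N)) hρ hμ σ).map_eq
  have he : (configPerm σ : LGConfig d (Matrix.specialUnitaryGroup (Fin N) ℂ) → _) = relabelConfig (edgePerm σ) :=
    funext (configPerm_eq_relabelConfig_edgePerm N σ)
  rwa [he] at h

end ZdSuN

end Summit.QuantumFields.GaugeBoot

end
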